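import Summits.BirchSwinnertonDyer.Rank1Residual.X6.RankZeroCertificateInertPair
import Summits.BirchSwinnertonDyer.Rank1Residual.Supersingular.X6RankZeroInertPairDefs
import HarnessLib

/-!
# Class X6 ∧ analytic rank `0` — the inert-pair certificate under its NAME: bridges onto ty2's `Supersingular.HasInertPair`
# (road (R2)), decided for every record; the six Rest cells and the T3 witness cell by name

Cell `bsd-print-x6` (D-0131 (2) print tier, key `x6`; HOME `run/shared/lean/pub/bsd-print-x6/`), typer seat ty3 (gen 5).
Sibling of `RankZeroCertificateInertPair.lean` (p561444: the Bool certificate `Record.inertPairAt`, the STRUCTURAL kernel theorems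
`Record.exists_inertPair_of_check` / `Record.not_exists_inertPair_of_check`, the census 113/113 @ `p ≥ 5` · 574/47 @ 3, the `hWeq`
adapters and the six Rest cells) and of ty2's `Supersingular/X6RankZeroInertPairDefs.lean` (p561619: `HasInertPair W p :=
∃ ℓ₁ ℓ₂ …` — by definition the structural statement, so every bridge below is the structural theorem itself). PARTITION (D-0054):
leaf X6 ∧ r = 0 (K3 row A6) — types-the-object-of; closes NONE. HONEST FRAMING: nothing here asserts BSD or any `L`-value; reduction
types and `ord_ℓ Δ_min` of explicit minimal models, PROVED from kernel-rechecked integer data.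

* `Record.hasInertPair_of_check` / `Record.not_hasInertPair_of_check`; `hasInertPair_iff_inertPairAt_of_mem` (decided on the display);
  `hasInertPair_of_mem` (every listed record at `p ≥ 5`: 113/113 — the 6 Rest AND the 107 Err cells);
  `errRest_inertPair_counts_five_le` (Err ∧ pair 107, Rest ∧ pair 6, no pair 0: a split of the Rest residual along `HasInertPair` leaves a
  part supported on ZERO census records at `p ≥ 5` — the planner's 19:48Z (iii));
* `hasInertPair_of_exists` (hWeq shape, any cell) and by name: `hasInertPair_cell_<label>_at<p>` for `138594b1, 246697a1, 321518d1,
  331554a1 @ 5`, `12927e1, 399190l1 @ 7` (Rest) and the T3 witness cell `22678e1 @ 5` (Err; bad `(2,75),(17,1),(23,1),(29,4)`).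

Consumers: p3-g2's road (I)/(R2) closer-shaped helper `eisensteinHalfFiveLe_inertPair_of_facts` (binders `ℓ₁ ℓ₂ … Mult … p ∤ ord`) — at a
census cell destructure `hasInertPair_cell_…` or use `PrintCert.multVal_cell_…` (p561444) to pick the pair; ty2's
`X6RankZero.exists_inertPairShapeField_of_hasInertPair` takes `HasInertPair W p` directly. beyond-print theorem: NO.
References: [SilvermanAEC2009] VII.5 Prop. 5.1; [CastellaWan2023] Thm 5.3 hypothesis shape (nothing asserted); [Cremona2006] Table 1.
-/

set_option autoImplicit false

open WeierstrassCurve Literature.NumberTheory.EllipticCurves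
  Literature.NumberTheory.EllipticCurves.Rank1Residual
open Summit.BirchSwinnertonDyer.Rank1Residual.Supersingular (HasInertPair)

namespace Summit.BirchSwinnertonDyer.Rank1Residual.X6.PrintCert

namespace Record

variable (r : Record)

/-- **`HasInertPair W p` for a certified record with the certificate** — ty2's predicate (p561619) is by definition the structural
statement of `exists_inertPair_of_check`. [cite: SilvermanAEC2009, VII.5 Prop. 5.1(b)] -/
theorem hasInertPair_of_check (hc : r.check = true) [r.curve.IsElliptic] [r.curve.IsGloballyMinimal]
    (h : r.inertPairAt = true) : HasInertPair r.curve r.p :=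
  r.exists_inertPair_of_check hc h

/-- **`¬ HasInertPair W p` for a certified record without the certificate.** [cite: SilvermanAEC2009, VII.5 Prop. 5.1(a) and (b)] -/
theorem not_hasInertPair_of_check (hc : r.check = true) [r.curve.IsElliptic] [r.curve.IsGloballyMinimal]
    (h : r.inertPairAt = false) : ¬ HasInertPair r.curve r.p :=
  r.not_exists_inertPair_of_check hc h

end Record

/-- **`HasInertPair` is DECIDED on the display**: for a listed record, `HasInertPair W p ↔ inertPairAt`.
[cite: SilvermanAEC2009, VII.5 Prop. 5.1(a) and (b)] -/
theorem hasInertPair_iff_inertPairAt_of_mem (r : Record) (hr : r ∈ allRecords) :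
    haveI := (r.elliptic_and_minimal_of_check (check_of_mem_of_certified certified_allRecords hr)).1
    haveI := (r.elliptic_and_minimal_of_check (check_of_mem_of_certified certified_allRecords hr)).2
    HasInertPair r.curve r.p ↔ r.inertPairAt = true := by
  have hc := check_of_mem_of_certified certified_allRecords hr
  haveI := (r.elliptic_and_minimal_of_check hc).1
  haveI := (r.elliptic_and_minimal_of_check hc).2
  refine ⟨fun h => ?_, fun h => r.hasInertPair_of_check hc h⟩
  by_contra hne
  exact r.not_hasInertPair_of_check hc (Bool.eq_false_iff.mpr hne) h

/-- **Every listed record at `p ≥ 5` has `HasInertPair`** (113/113: the 6 Rest cells and the 107 Err cells).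
[cite: SilvermanAEC2009, VII.5 Prop. 5.1(b)] -/
theorem hasInertPair_of_mem (r : Record) (hr : r ∈ allRecords) (h5 : 5 ≤ r.p) :
    haveI := (r.elliptic_and_minimal_of_check (check_of_mem_of_certified certified_allRecords hr)).1
    haveI := (r.elliptic_and_minimal_of_check (check_of_mem_of_certified certified_allRecords hr)).2
    HasInertPair r.curve r.p :=
  exists_inertPair_of_mem r hr h5

/-- The Err ∣ Rest × inert-pair cross-count at `p ≥ 5`: Err ∧ pair 107, Rest ∧ pair 6, no pair 0 — a split of the Rest residual
along `HasInertPair` leaves a part supported on ZERO census records at `p ≥ 5`. [folklore] -/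
theorem errRest_inertPair_counts_five_le :
    (allRecords.filter fun r => 5 ≤ r.p ∧ r.errAt = true ∧ r.inertPairAt = true).length = 107 ∧
    (allRecords.filter fun r => 5 ≤ r.p ∧ r.restAt = true ∧ r.inertPairAt = true).length = 6 ∧
    (allRecords.filter fun r => 5 ≤ r.p ∧ r.inertPairAt = false).length = 0 := by
  decide +kernel

section NamedAdapters

variable {rs : List Record} {W : WeierstrassCurve ℚ} [W.IsElliptic] [W.IsGloballyMinimal] {a1 a2 a3 a4 a6 : ℤ}

/-- **`HasInertPair W p` in the `hWeq` shape** from a certified list containing a record with these a-invariants, this `p` and the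
certificate (membership `by decide +kernel` in the part `recordsNN` holding the label). [cite: SilvermanAEC2009, VII.5 Prop. 5.1(b)] -/
theorem hasInertPair_of_exists (hrs : certified rs = true) {p : ℕ}
    (h : ∃ r ∈ rs, r.ainvs = [a1, a2, a3, a4, a6] ∧ r.p = p ∧ r.inertPairAt = true) (hWeq : W = ⟨a1, a2, a3, a4, a6⟩) :
    HasInertPair W p :=
  exists_inertPair_of_exists hrs h hWeq

/-- `138594b1 @ 5`: `HasInertPair W 5`. [cite: Cremona2006, Table 1 (Cremona label 138594b1)] -/
theorem hasInertPair_cell_138594b1_at5 (hWeq : W = ⟨1, 0, 0, -1443, -21219⟩) : HasInertPair W 5 :=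
  inertPair_cell_138594b1_at5 hWeq

/-- `246697a1 @ 5`: `HasInertPair W 5`. [cite: Cremona2006, Table 1 (Cremona label 246697a1)] -/
theorem hasInertPair_cell_246697a1_at5 (hWeq : W = ⟨0, 0, 1, -292934695, -1929764585205⟩) : HasInertPair W 5 :=
  inertPair_cell_246697a1_at5 hWeq

/-- `321518d1 @ 5`: `HasInertPair W 5`. [cite: Cremona2006, Table 1 (Cremona label 321518d1)] -/
theorem hasInertPair_cell_321518d1_at5 (hWeq : W = ⟨1, 0, 0, -80858, -9082420⟩) : HasInertPair W 5 :=
  inertPair_cell_321518d1_at5 hWeq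

/-- `331554a1 @ 5`: `HasInertPair W 5`. [cite: Cremona2006, Table 1 (Cremona label 331554a1)] -/
theorem hasInertPair_cell_331554a1_at5 (hWeq : W = ⟨1, 0, 0, -3453, -78387⟩) : HasInertPair W 5 :=
  inertPair_cell_331554a1_at5 hWeq

/-- `12927e1 @ 7`: `HasInertPair W 7`. [cite: Cremona2006, Table 1 (Cremona label 12927e1)] -/
theorem hasInertPair_cell_12927e1_at7 (hWeq : W = ⟨1, 0, 0, -42189461, -105479619702⟩) : HasInertPair W 7 :=
  inertPair_cell_12927e1_at7 hWeq

/-- `399190l1 @ 7`: `HasInertPair W 7`. [cite: Cremona2006, Table 1 (Cremona label 399190l1)] -/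
theorem hasInertPair_cell_399190l1_at7 (hWeq : W = ⟨1, -1, 1, -8615202972, -2594053676135591⟩) : HasInertPair W 7 :=
  inertPair_cell_399190l1_at7 hWeq

/-- The route's T3 witness cell `22678e1 @ 5` (an Err cell; bad `(2,75),(17,1),(23,1),(29,4)` — `5 ∣ 75` at `2`, the other three
ramified): `HasInertPair W 5`. [cite: Cremona2006, Table 1 (Cremona label 22678e1)] -/
theorem hasInertPair_cell_22678e1_at5 (hWeq : W = ⟨1, 0, 0, 3140254662, -139987982322460⟩) : HasInertPair W 5 :=
  hasInertPair_of_exists certified_records14 (by decide +kernel) hWeq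

end NamedAdapters

end Summit.BirchSwinnertonDyer.Rank1Residual.X6.PrintCert
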